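import Literature.MathematicalPhysics.QuantumFieldTheory.Balaban1983to89.B9Thm310Whole
import Literature.MathematicalPhysics.QuantumFieldTheory.Balaban1983to89.B13EntrywiseWalks
import Literature.MathematicalPhysics.QuantumFieldTheory.Balaban1983to89.B13JointWalkExpansionNeumann

/-!
# `Balaban1983to89.B13WalksOfB9Factors` — T. Bałaban, *Propagators for lattice gauge theories in a background field*, Commun.
Math. Phys. **99** (1985) 389–434 [Balaban1985BackgroundPropagators] («[13]» of [Balaban1988RG2Cluster]), Thm 3.10 pp. 413–416:
(3.87) `G₀ = Σ_□ h_□G_□h_□`, (3.105) `Δ_aG₀ = I − R`, (3.106) `G = G₀(I − R)⁻¹ = Σ G₀Rⁿ`, (3.107)–(3.108) — THE N06 → N10 OBJECT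
KNIT AT PRINT's OWN REGIME: from node N06's TYPED LETTERS of Theorem 3.10 at one family member and one (real) background `U`
(`B9Thm310Whole.Ops310` on the torus frame `torusGeom Nf η L M`, the (3.89)-type factor bounds `Factors389`, the Cor. 3.6
legs `Local342G` of the local propagators `G_□(U)`, the partition ∕ count letters of `StaticOK310`, the identities
`Identities310`: `GΔ_a = I`, (3.105)) to the [B13] CURRENCY of node N10: ENTRYWISE (3.108)-type letters
(`B13EntrywiseWalks.RawEntryLetters`) of the remainder `R(U)` and of the parametrix `G₀(U)` read as matrices, hence — by the
tree's walk calculus (`B13EntrywiseWalks.jointWalkExpansion_rawEntrywise`, `B13JointWalkExpansionNeumann.jointWalkExpansion_neumann_right`)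
— a JOINT WALK EXPANSION of `G(U) = G₀(U)(I − R(U))⁻¹` on the torus under «M sufficiently large», and its entrywise decay:
the input letter `hEL` of the N10 junction's entrywise edition (`Summit…N10AtRecord11B13WalksBlockEntrywise`) for `G(U)` at
that background, FROM N06's hypotheses of record, BY NAME

statement-level bookkeeping over published theorems with citation tags; kernel-checked compositions of tree theorems;
nothing here is a claim about the Yang–Mills mass gap.

WHY (cell `pub-ymgap`, D-0062 Track A, nodes N06 = [B9] → N10 = [B13]; seat `pub-ymgap-dag-n10-c` g4, module 33; FAN-OUT v1.1
§N10 s1 ≡ §N06 s4).  The DAG's in-edge N06 → N10 is [II] p. 13's sentence *"This construction was discussed in [13] for all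
operators determining Δ_k"*.  N06's certificate consumes Theorem 3.10 through `B9Thm310Whole` (seat n06-k), whose letters are
abstract linear maps on a site-indexed function space with BLOCK-SUP majorants; N10's junction consumes ENTRYWISE letters of
complex matrices (census v5 class A2′, entrywise form).  THIS FILE is the dictionary between the two currencies at the
object level and the first theorem in the tree that starts from N06's typed Thm-3.10 hypotheses and ends in N10's input
shape.  HONEST SCOPE: ONE background `U` at a time, u-CONSTANT families (the uniformity on the complex `(𝐔,𝐉)`-ball that the
junction finally needs is [II] p. 15's analyticity statement — a separate in-edge, not touched); the σ-region `X` and the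
configuration space `E` are free parameters (σ-free data); the letters `θ₀M⁻¹`, `B₀η²`, `N`, `N_F`, `δ₀` are N06's.

WHAT THIS FILE PROVES (all `theorem`s; no `def`, no instance, no notation).
§1 `abs_toMatrix_le_of_hasMajorant` — a block-sup majorant bounds every matrix entry: `|M(T)_{xx′}| ≤ K(blk x, blk x′)`
   (test function = the indicator of `x′`, [4] (2.51) read at one point); `toMatrix_mulOp` (multiplication by `h` is the
   diagonal matrix), `toMatrix_sandwich_apply` (`M(h·T·h)_{xx′} = h(x)·M(T)_{xx′}·h(x′)`).
§2 ★ `rawEntryLetters_remainder` — `Factors389` + the count `N_F` ⟹ `RawEntryLetters` of `R(U) = Σ_a R_a(U)` (as a complex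
   matrix, u-constant) with `B = N_F·θ₀M⁻¹`, rate `δ₀`; ★ `rawEntryLetters_parametrix` — `Local342G.e0` + `|h| ≤ 1` + supports
   + the count `N` ⟹ `RawEntryLetters` of `G₀(U)` with `B = N·B₀η²`, rate `δ₀`.
§3 `toMatrix_G_mul_one_sub_R` — the identities `GΔ_a = I` and (3.105) give `M(G)·(1 − M(R)) = M(G₀)` over ℂ;
   `toMatrix_G_eq_parametrix_mul_inv` — (3.106) for N06's letters: `1 − M(R)` invertible and `M(G) = M(G₀)(1 − M(R))⁻¹` under
   «M sufficiently large» (invertibility from the remainder's walk data alone);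
   ★ `jointWalkExpansion_G_of_ops310` — under «M sufficiently large» (`q = (m·c_μ)·(N_Fθ₀M⁻¹(m²+1))·c_μ < 1`, `m` the fibre
   bound of `blk`, `c_μ` the (2.61) constant at a junction rate `μ`, target `(ρ, ε, κ)` with `κ + 2μ ≤ ρ − ε`, `ρ + μ ≤ δ₀`):
   `G(U)` read as a complex matrix has a σ-free `JointWalkExpansion` through any non-empty `X` on any ball of any configuration
   space, constant `N·B₀η²(m²+1)·(1 − q)⁻¹`, rate `ρ` (∃-form over the chain terms); ★ `rawEntryLetters_G_of_ops310` — hence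
   `‖G(U)_{xx′}‖ ≤ N·B₀η²(m²+1)(1 − q)⁻¹·e^{−κ·d(blk x, blk x′)}`: (3.108) for `G(U)` IN B13 CURRENCY.
HONEST FRAMING: kernel-level dictionary + composition over N06's HYPOTHESIS SCHEMAS (`Factors389`, `Local342G`, `StaticOK310`,
`Identities310` are Prop-structures of printed shape, inhabited by nobody yet for Bałaban's operators — GAPS G-B9-05∕06a∕07);
NOTHING of Bałaban's is constructed or asserted; neither N06 nor N10 is discharged; count-neutral; no `sorry`, no new named
fact; standard axioms; nothing continuum ∕ ℝ⁴ ∕ OS ∕ mass gap ∕ Clay.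
-/

noncomputable section

namespace Literature.MathematicalPhysics.QuantumFieldTheory.Balaban1983to89.B13WalksOfB9Factors

open Metric Set Finset
open scoped Matrix
open Literature.MathematicalPhysics.QuantumFieldTheory.Balaban1983to89
open Literature.MathematicalPhysics.QuantumFieldTheory.Balaban1983to89.B6RandomWalk (HasMajorant BlockSupp)
open Literature.MathematicalPhysics.QuantumFieldTheory.Balaban1983to89.B9Thm37Sum (mulOp)
open Literature.MathematicalPhysics.QuantumFieldTheory.Balaban1983to89.B9Thm34Ext (toB6)
open Literature.MathematicalPhysics.QuantumFieldTheory.Balaban1983to89.B9Thm37GlueTorus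
  (torusGeom tdist1 tdist1_nonneg len_torusGeom)
open Literature.MathematicalPhysics.QuantumFieldTheory.Balaban1983to89.B9SectDWalk (DomBy)
open Literature.MathematicalPhysics.QuantumFieldTheory.Balaban1983to89.TreeLengthTorus (TPt)
open Literature.MathematicalPhysics.QuantumFieldTheory.Balaban1983to89.B5TorusCover (UT)
open Literature.MathematicalPhysics.QuantumFieldTheory.Balaban1983to89.B9Thm310Whole
  (Ops310 Factors389 Local342G Identities310 StaticOK310 Sizes310)
open Literature.MathematicalPhysics.QuantumFieldTheory.Balaban1983to89.B13JointWalkExpansion (JointWalkExpansion)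
open Literature.MathematicalPhysics.QuantumFieldTheory.Balaban1983to89.B13EntrywiseWalks
  (RawEntryLetters rawEntryTerm entryDist jointWalkExpansion_rawEntrywise domBy_entryDist)
open Literature.MathematicalPhysics.QuantumFieldTheory.Balaban1983to89.B13JointWalkExpansionNeumann
  (jointWalkExpansion_neumann_right one_sub_mul_inv_of_jointWalkExpansion)
open Literature.MathematicalPhysics.QuantumFieldTheory.Balaban1983to89.B13JointWalkExpansionSymmetrize (jointWalkExpansion_congr_on)
open Literature.MathematicalPhysics.QuantumFieldTheory.Balaban1983to89.B13LocalKernelWalks (rowSum_torus)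

variable {X : Type} [Fintype X] [DecidableEq X]

/-! ## §1. Block-sup majorants bound matrix entries; multiplication operators are diagonal matrices -/

section Entries

variable {G6 : B6.Geometry}

/-- **A BLOCK-SUP MAJORANT BOUNDS EVERY MATRIX ENTRY** ([4] (2.51) *"|(Tλ)(x)| ≤ K(y, y′)|λ|, supp λ ⊂ B(y′)"* read at the
indicator of one point `x′`, a test function supported in the block of `x′` and bounded by `1`): `|M(T)_{xx′}| ≤ K(blk x, blk x′)`.
[cite: Balaban1984PropagatorsII, (2.51) p.232; Balaban1985BackgroundPropagators, (3.89) p.409] -/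
theorem abs_toMatrix_le_of_hasMajorant {blk : X → G6.Site} {T : Module.End ℝ (X → ℝ)} {K : G6.Site → G6.Site → ℝ}
    (h : HasMajorant (g := G6) blk T K) (x x' : X) : |LinearMap.toMatrix' T x x'| ≤ K (blk x) (blk x') := by
  rw [LinearMap.toMatrix'_apply]
  have hB : BlockSupp (g := G6) blk (Pi.single x' (1 : ℝ)) (blk x') 1 :=
    { nonneg := zero_le_one
      bound := fun z _ => by
        rw [Pi.single_apply]; split_ifs <;> simp
      off := fun z hz => by
        rw [Pi.single_apply, if_neg]
        rintro rfl; exact hz rfl }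
  simpa using h (blk x') (Pi.single x' 1) 1 hB x

/-- Multiplication by a lattice function is the diagonal matrix. [cite: Balaban1985BackgroundPropagators, (3.87) p.409] -/
theorem toMatrix_mulOp (f : X → ℝ) : LinearMap.toMatrix' (mulOp f) = Matrix.diagonal f := by
  ext x x'
  rw [LinearMap.toMatrix'_apply, Matrix.diagonal_apply, B9Thm37Sum.mulOp_apply, Pi.single_apply]
  by_cases h : x = x'
  · subst h; simp
  · simp [h]

/-- The entries of a sandwich `h·T·h`: `M(h·T·h)_{xx′} = h(x)·M(T)_{xx′}·h(x′)`. [cite: Balaban1985BackgroundPropagators, (3.87) p.409] -/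
theorem toMatrix_sandwich_apply (f : X → ℝ) (T : Module.End ℝ (X → ℝ)) (x x' : X) :
    LinearMap.toMatrix' (mulOp f * T * mulOp f) x x' = f x * LinearMap.toMatrix' T x x' * f x' := by
  rw [LinearMap.toMatrix'_mul, LinearMap.toMatrix'_mul, toMatrix_mulOp, Matrix.mul_diagonal, Matrix.diagonal_mul]

end Entries

/-! ## §2. N06's letters ⟹ entrywise letters of the remainder and of the parametrix -/

section Letters

variable {ν : ℕ} {Nf : Fin ν → ℕ} [∀ i, NeZero (Nf i)] {η L M : ℝ}
variable {Bg : B9.Backgrounds} {Y ι A : Type} [Fintype ι] [Fintype A]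
variable {E : Type*} [NormedAddCommGroup E] [NormedSpace ℂ E]
variable (𝔬 : Ops310 (torusGeom Nf η L M) Bg X Y ι A)
variable {U : Bg.Cfg} {Rr : ℝ} {H : Prop} {θ₀ δ₀ B₀ : ℝ}

omit [Fintype X] [DecidableEq X] in
/-- The norm of a real matrix entry read in ℂ is its absolute value. [folklore] -/
private theorem norm_map_ofReal_apply (Mx : Matrix X X ℝ) (x x' : X) :
    ‖(Mx.map (algebraMap ℝ ℂ)) x x'‖ = |Mx x x'| := by
  rw [Matrix.map_apply]
  exact Complex.norm_real _

omit [Fintype ι] in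
/-- **THE REMAINDER's ENTRYWISE LETTERS FROM `Factors389`**: with the (3.89)-type block-sup majorants
`[y ∈ X_a]·θ₀M⁻¹·e^{−δ₀d(y,y′)}` of the factors `R_a(U)` and the count letter `N_F` (every block meets at most `N_F` localization
domains), the remainder `R(U) = Σ_a R_a(U)` (p. 414), read as a complex matrix constant in the configuration, has entries
`≤ N_F·θ₀M⁻¹·e^{−δ₀·d₁(blk x, blk x′)}` on every ball and is (trivially) entrywise holomorphic.
[cite: Balaban1985BackgroundPropagators, (3.89) p.409, p.413, (3.105) p.414, (3.108) p.416] -/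
theorem rawEntryLetters_remainder (hF : Factors389 𝔬 Rr H θ₀ δ₀ U) {NF : ℝ}
    (hcntF : ∀ s : UT Nf, (∑ a, if s ∈ 𝔬.SF a then (1 : ℝ) else 0) ≤ NF) (hθ₀ : 0 ≤ θ₀ * M⁻¹) (hNF : 0 ≤ NF) (Rball : ℝ) :
    RawEntryLetters (Nf := Nf) (fun (_ : E) => (LinearMap.toMatrix' (∑ a, 𝔬.Rf U a)).map (algebraMap ℝ ℂ)) 𝔬.blk Rball δ₀
      (NF * (θ₀ * M⁻¹)) where
  decay := fun u _ x x' => by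
    rw [norm_map_ofReal_apply, map_sum, Matrix.sum_apply]
    have hterm : ∀ a, |LinearMap.toMatrix' (𝔬.Rf U a) x x'| ≤
        (if 𝔬.blk x ∈ 𝔬.SF a then (1 : ℝ) else 0) * ((θ₀ * M⁻¹) * Real.exp (-(δ₀ * tdist1 Nf (𝔬.blk x) (𝔬.blk x')))) := by
      intro a
      have h := abs_toMatrix_le_of_hasMajorant (hF.fac a) x x'
      by_cases hx : 𝔬.blk x ∈ 𝔬.SF a
      · rw [if_pos hx] at h; rw [if_pos hx, one_mul]
        simpa [mul_assoc] using h
      · rw [if_neg hx] at h; rw [if_neg hx, zero_mul]; exact h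
    calc |∑ a, LinearMap.toMatrix' (𝔬.Rf U a) x x'|
        ≤ ∑ a, |LinearMap.toMatrix' (𝔬.Rf U a) x x'| := Finset.abs_sum_le_sum_abs _ _
      _ ≤ ∑ a, (if 𝔬.blk x ∈ 𝔬.SF a then (1 : ℝ) else 0) * ((θ₀ * M⁻¹) * Real.exp (-(δ₀ * tdist1 Nf (𝔬.blk x) (𝔬.blk x')))) :=
          Finset.sum_le_sum fun a _ => hterm a
      _ = (∑ a, if 𝔬.blk x ∈ 𝔬.SF a then (1 : ℝ) else 0) * ((θ₀ * M⁻¹) * Real.exp (-(δ₀ * tdist1 Nf (𝔬.blk x) (𝔬.blk x')))) := by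
          rw [Finset.sum_mul]
      _ ≤ NF * ((θ₀ * M⁻¹) * Real.exp (-(δ₀ * tdist1 Nf (𝔬.blk x) (𝔬.blk x')))) :=
          mul_le_mul_of_nonneg_right (hcntF _) (mul_nonneg hθ₀ (Real.exp_pos _).le)
      _ = NF * (θ₀ * M⁻¹) * Real.exp (-(δ₀ * tdist1 Nf (𝔬.blk x) (𝔬.blk x'))) := by ring
  holo := fun _ _ => differentiableOn_const _
  B_nonneg := mul_nonneg hNF hθ₀

omit [Fintype A] in
/-- **THE PARAMETRIX's ENTRYWISE LETTERS FROM `Local342G`**: with the Cor. 3.6 leg `B₀·(L^jη)²·e^{−δ₀d}` of every local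
propagator `G_□(U)` (block-sup majorant), `|h_□| ≤ 1`, `supp h_□ ⊂ S_□` and the count `N` (every block meets at most `N` of
the `S_□`), the parametrix `G₀(U) = Σ_□ h_□G_□(U)h_□` ((3.87)), read as a complex matrix constant in the configuration, has
entries `≤ N·B₀η²·e^{−δ₀·d₁(blk x, blk x′)}` (one-scale torus: `L^jη = η`). [cite: Balaban1985BackgroundPropagators, (3.87) p.409, Cor. 3.6 p.408, (3.108) p.416] -/
theorem rawEntryLetters_parametrix (hG0 : Local342G 𝔬 Rr H B₀ δ₀ U) {N : ℝ}
    (hh : ∀ i x, |𝔬.h i x| ≤ 1) (hS : ∀ i x, 𝔬.h i x ≠ 0 → 𝔬.blk x ∈ 𝔬.S i)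
    (hcnt : ∀ s : UT Nf, (∑ i, if s ∈ 𝔬.S i then (1 : ℝ) else 0) ≤ N) (hB₀ : 0 ≤ B₀) (hN : 0 ≤ N) (Rball : ℝ) :
    RawEntryLetters (Nf := Nf)
      (fun (_ : E) => (LinearMap.toMatrix' (∑ i, mulOp (𝔬.h i) * 𝔬.Gsq U i * mulOp (𝔬.h i))).map (algebraMap ℝ ℂ))
      𝔬.blk Rball δ₀ (N * (B₀ * η ^ 2)) where
  decay := fun u _ x x' => by
    rw [norm_map_ofReal_apply, map_sum, Matrix.sum_apply]
    have hterm : ∀ i, |LinearMap.toMatrix' (mulOp (𝔬.h i) * 𝔬.Gsq U i * mulOp (𝔬.h i)) x x'| ≤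
        (if 𝔬.blk x ∈ 𝔬.S i then (1 : ℝ) else 0) * ((B₀ * η ^ 2) * Real.exp (-(δ₀ * tdist1 Nf (𝔬.blk x) (𝔬.blk x')))) := by
      intro i
      rw [toMatrix_sandwich_apply, abs_mul, abs_mul]
      have hG : |LinearMap.toMatrix' (𝔬.Gsq U i) x x'| ≤ (B₀ * η ^ 2) * Real.exp (-(δ₀ * tdist1 Nf (𝔬.blk x) (𝔬.blk x'))) := by
        have h := abs_toMatrix_le_of_hasMajorant (hG0.e0 i) x x'
        simpa [len_torusGeom, mul_assoc] using h
      have hGnn : 0 ≤ (B₀ * η ^ 2) * Real.exp (-(δ₀ * tdist1 Nf (𝔬.blk x) (𝔬.blk x'))) := by positivity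
      by_cases hx : 𝔬.blk x ∈ 𝔬.S i
      · rw [if_pos hx, one_mul]
        calc |𝔬.h i x| * |LinearMap.toMatrix' (𝔬.Gsq U i) x x'| * |𝔬.h i x'|
            ≤ 1 * ((B₀ * η ^ 2) * Real.exp (-(δ₀ * tdist1 Nf (𝔬.blk x) (𝔬.blk x')))) * 1 :=
              mul_le_mul (mul_le_mul (hh i x) hG (abs_nonneg _) zero_le_one) (hh i x') (abs_nonneg _)
                (mul_nonneg zero_le_one hGnn)
          _ = (B₀ * η ^ 2) * Real.exp (-(δ₀ * tdist1 Nf (𝔬.blk x) (𝔬.blk x'))) := by ring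
      · have h0 : 𝔬.h i x = 0 := by
          by_contra hne; exact hx (hS i x hne)
        rw [h0, abs_zero, zero_mul, zero_mul, if_neg hx, zero_mul]
    calc |∑ i, LinearMap.toMatrix' (mulOp (𝔬.h i) * 𝔬.Gsq U i * mulOp (𝔬.h i)) x x'|
        ≤ ∑ i, |LinearMap.toMatrix' (mulOp (𝔬.h i) * 𝔬.Gsq U i * mulOp (𝔬.h i)) x x'| := Finset.abs_sum_le_sum_abs _ _
      _ ≤ ∑ i, (if 𝔬.blk x ∈ 𝔬.S i then (1 : ℝ) else 0) * ((B₀ * η ^ 2) * Real.exp (-(δ₀ * tdist1 Nf (𝔬.blk x) (𝔬.blk x')))) :=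
          Finset.sum_le_sum fun i _ => hterm i
      _ = (∑ i, if 𝔬.blk x ∈ 𝔬.S i then (1 : ℝ) else 0) * ((B₀ * η ^ 2) * Real.exp (-(δ₀ * tdist1 Nf (𝔬.blk x) (𝔬.blk x')))) := by
          rw [Finset.sum_mul]
      _ ≤ N * ((B₀ * η ^ 2) * Real.exp (-(δ₀ * tdist1 Nf (𝔬.blk x) (𝔬.blk x')))) :=
          mul_le_mul_of_nonneg_right (hcnt _) (by positivity)
      _ = N * (B₀ * η ^ 2) * Real.exp (-(δ₀ * tdist1 Nf (𝔬.blk x) (𝔬.blk x'))) := by ring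
  holo := fun _ _ => differentiableOn_const _
  B_nonneg := by positivity

end Letters

/-! ## §3. (3.106)–(3.108) for `G(U)` in B13 currency from N06's letters -/

section Thm310

variable {ν : ℕ} {Nf : Fin ν → ℕ} [∀ i, NeZero (Nf i)] {η L M : ℝ}
variable {Bg : B9.Backgrounds} {Y ι A : Type} [Fintype ι] [Fintype A]
variable {E : Type*} [NormedAddCommGroup E] [NormedSpace ℂ E]
variable (𝔬 : Ops310 (torusGeom Nf η L M) Bg X Y ι A)
variable {U : Bg.Cfg} {Rr : ℝ} {H : Prop}

/-- **`M(G)·(1 − M(R)) = M(G₀)` over ℂ** from `GΔ_a = I` and (3.105) `Δ_aG₀ = I − R` (`Identities310.inv ∕ eq3105`): the algebra of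
(3.106) before inverting. [cite: Balaban1985BackgroundPropagators, (3.105)–(3.106) p.414] -/
theorem toMatrix_G_mul_one_sub_R (hI : Identities310 𝔬 Rr H U) :
    (LinearMap.toMatrix' (𝔬.G U)).map (algebraMap ℝ ℂ) *
        (1 - (LinearMap.toMatrix' (∑ a, 𝔬.Rf U a)).map (algebraMap ℝ ℂ)) =
      (LinearMap.toMatrix' (∑ i, mulOp (𝔬.h i) * 𝔬.Gsq U i * mulOp (𝔬.h i))).map (algebraMap ℝ ℂ) := by
  -- real identity: M(G)·(1 − M(R)) = M(G)·M(Δa)·M(G₀) = M(G₀)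
  have hreal : LinearMap.toMatrix' (𝔬.G U) * (1 - LinearMap.toMatrix' (∑ a, 𝔬.Rf U a)) =
      LinearMap.toMatrix' (∑ i, mulOp (𝔬.h i) * 𝔬.Gsq U i * mulOp (𝔬.h i)) := by
    have h1 : (1 : Matrix X X ℝ) - LinearMap.toMatrix' (∑ a, 𝔬.Rf U a) =
        LinearMap.toMatrix' (𝔬.Δa U) * LinearMap.toMatrix' (∑ i, mulOp (𝔬.h i) * 𝔬.Gsq U i * mulOp (𝔬.h i)) := by
      rw [← LinearMap.toMatrix'_mul, hI.eq3105, map_sub, LinearMap.toMatrix'_one]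
    rw [h1, ← Matrix.mul_assoc, ← LinearMap.toMatrix'_mul, hI.inv, LinearMap.toMatrix'_one, Matrix.one_mul]
  have h := congrArg (algebraMap ℝ ℂ).mapMatrix hreal
  rw [map_mul, map_sub, map_one] at h
  simpa only [RingHom.mapMatrix_apply] using h

/-- **THEOREM 3.10 FOR `G(U)` IN [B13] CURRENCY, FROM N06's TYPED LETTERS** ((3.106) `G = G₀(I − R)⁻¹ = Σ G₀Rⁿ`, (3.107)–(3.108)).
DATA (all N06's, `B9Thm310Whole`): the operator letters `𝔬` on the torus frame, at ONE background `U`; the factor bounds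
`Factors389 𝔬 Rr H θ₀ δ₀ U`; the Cor. 3.6 legs `Local342G 𝔬 Rr H B₀ δ₀ U`; the partition letters `|h_□| ≤ 1`,
`supp h_□ ⊂ S_□` and the counts `N`, `N_F`; the identities `Identities310 𝔬 Rr H U`; signs `θ₀M⁻¹, B₀, N, N_F ≥ 0`.
B13 PARAMETERS (free): any constants record `c`, any non-empty σ-region `X`, any configuration space and ball radius (the
families are u-constant), the fibre bound `m` of `blk`, a junction rate `μ > 0` and a target `(ρ, ε, κ)` with `0 ≤ ε`, `0 ≤ κ`,
`κ + 2μ ≤ ρ − ε`, `ρ + μ ≤ δ₀`.  «M SUFFICIENTLY LARGE»: `q = (m·c_μ)·(N_Fθ₀M⁻¹·(m² + 1))·c_μ < 1`, `c_μ = c₀(1,μ)^ν`.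
CONCLUSION (∃-form over the chain data): a σ-free `JointWalkExpansion` of `G(U)` (read as a complex matrix) through `X` at
`(R, ε, κ, N·B₀η²·(m²+1)·(1 − q)⁻¹)`, rate `ρ`, with walk distances dominating `d₁`.
[cite: Balaban1985BackgroundPropagators, (3.87) p.409, (3.89) p.409, (3.105)–(3.106) p.414, Thm 3.10 (3.107)–(3.108) p.416, (3.93) p.410, p.422; Balaban1988RG2Cluster, p.13, p.15; Balaban1984PropagatorsII, (2.51) p.232, Lemma 2.1 (2.61) p.234] -/
theorem jointWalkExpansion_G_of_ops310 {θ₀ δ₀ B₀ N NF : ℝ}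
    (hF : Factors389 𝔬 Rr H θ₀ δ₀ U) (hG0 : Local342G 𝔬 Rr H B₀ δ₀ U) (hI : Identities310 𝔬 Rr H U)
    (hh : ∀ i x, |𝔬.h i x| ≤ 1) (hS : ∀ i x, 𝔬.h i x ≠ 0 → 𝔬.blk x ∈ 𝔬.S i)
    (hcnt : ∀ s : UT Nf, (∑ i, if s ∈ 𝔬.S i then (1 : ℝ) else 0) ≤ N)
    (hcntF : ∀ s : UT Nf, (∑ a, if s ∈ 𝔬.SF a then (1 : ℝ) else 0) ≤ NF)
    (hθ₀ : 0 ≤ θ₀ * M⁻¹) (hB₀ : 0 ≤ B₀) (hN : 0 ≤ N) (hNF : 0 ≤ NF)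
    (c : B13.Consts) {dσ Nσ : ℕ} (Xσ : Finset (UT Nf)) (hXσ : Xσ.Nonempty) (Rball : ℝ)
    {m : ℕ} (hfib : ∀ y : UT Nf, (Finset.univ.filter fun k => 𝔬.blk k = y).card ≤ m)
    {ρ ε κ μ : ℝ} (hμ : 0 < μ) (hε : 0 ≤ ε) (hκ : 0 ≤ κ) (hwin : κ + 2 * μ ≤ ρ - ε) (hρδ : ρ + μ ≤ δ₀)
    (hq : (m * B6.c0 1 μ ^ ν) * ((NF * (θ₀ * M⁻¹)) * (m * m + 1)) * B6.c0 1 μ ^ ν < 1) :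
    ∃ (W : Type) (T : W → (TPt dσ Nσ → ℂ) → E → Matrix X X ℂ) (SX : Set W) (Aw : W → ℝ) (D : W → UT Nf → UT Nf → ℝ),
      JointWalkExpansion c 𝔬.blk 𝔬.blk (fun (_ : TPt dσ Nσ → ℂ) (_ : E) => (LinearMap.toMatrix' (𝔬.G U)).map (algebraMap ℝ ℂ))
          Xσ Rball ε κ ((N * (B₀ * η ^ 2)) * (m * m + 1) * (1 - (m * B6.c0 1 μ ^ ν) * ((NF * (θ₀ * M⁻¹)) * (m * m + 1)) *
            B6.c0 1 μ ^ ν)⁻¹) T SX Aw D ρ ∧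
        ∀ ω, DomBy (toB6 (torusGeom Nf 0 0 0) 0 True) (D ω) := by
  have hc : 0 ≤ B6.c0 1 μ ^ ν := pow_nonneg (B6RandomWalk.c0_nonneg 1 μ) ν
  have hρε : 0 < ρ - ε := by linarith
  -- the two entrywise data
  have hLR := rawEntryLetters_remainder (E := E) 𝔬 hF hcntF hθ₀ hNF Rball
  have hLG := rawEntryLetters_parametrix (E := E) 𝔬 hG0 hh hS hcnt hB₀ hN Rball
  -- packaging length `Lw` with `|X × X| ≤ (ρ − ε)·Lw`
  set Lw : ℝ := (Fintype.card (X × X) : ℝ) / (ρ - ε) with hLw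
  have hLw0 : 0 ≤ Lw := div_nonneg (Nat.cast_nonneg _) hρε.le
  have hLwW : (Fintype.card (X × X) : ℝ) ≤ (ρ - ε) * Lw := by
    rw [hLw, mul_div_cancel₀ _ hρε.ne']
  -- both packagings at per-term rate δ₀, drop `δ₀ − (ρ − ε)`, torus rate `κ + μ`
  have hLwW' : (Fintype.card (X × X) : ℝ) ≤ (δ₀ - (δ₀ - (ρ - ε))) * Lw := by
    have e : δ₀ - (δ₀ - (ρ - ε)) = ρ - ε := by ring
    rw [e]; exact hLwW
  have hK := jointWalkExpansion_rawEntrywise (d := dσ) (N' := Nσ) c hXσ hLR (ε := δ₀ - (ρ - ε)) (kap := κ + μ) (L := Lw)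
    (by linarith) (by linarith) hLw0 hLwW' hfib
  have hS' := jointWalkExpansion_rawEntrywise (d := dσ) (N' := Nσ) c hXσ hLG (ε := δ₀ - (ρ - ε)) (kap := κ + μ) (L := Lw)
    (by linarith) (by linarith) hLw0 hLwW' hfib
  -- the resolvent step (26b), seed = parametrix, step family = remainder
  have h := jointWalkExpansion_neumann_right (σ₁ := μ) (σ' := μ) (ρ := ρ) (ε := ε) (κ := κ) hK hS'
    (fun ω => domBy_entryDist hLw0 ω) (fun ω => domBy_entryDist hLw0 ω) hfib (rowSum_torus Nf hμ) (rowSum_torus Nf hμ) hμ.le hμ.le hc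
    (by linarith) hε (by linarith) hρδ (by linarith) (by linarith) (by linarith) (mul_nonneg hLR.B_nonneg (by positivity))
    (mul_nonneg hLG.B_nonneg (by positivity)) hκ (by linarith) (by linarith) hq
  -- the kernel: `G₀·(1 − R)⁻¹ = G` (invertibility from the walk data)
  have hinv : ∀ (σ₀ : TPt dσ Nσ → ℂ), (∀ j, ‖σ₀ j‖ ≤ Real.exp c.κ₁) → ∀ u ∈ ball (0 : E) Rball,
      (1 - (LinearMap.toMatrix' (∑ a, 𝔬.Rf U a)).map (algebraMap ℝ ℂ)) *
        (1 - (LinearMap.toMatrix' (∑ a, 𝔬.Rf U a)).map (algebraMap ℝ ℂ))⁻¹ = 1 :=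
    fun σ₀ hσ₀ u hu => one_sub_mul_inv_of_jointWalkExpansion (σ₁ := μ) (σ' := μ) (ρ := ρ) hK (fun ω => domBy_entryDist hLw0 ω)
      hfib (rowSum_torus Nf hμ) (rowSum_torus Nf hμ) hμ.le hμ.le hc (by linarith) (by linarith) hρδ (by linarith)
      (mul_nonneg hLR.B_nonneg (by positivity)) (by linarith) hq hσ₀ hu
  refine ⟨_, _, _, _, _, jointWalkExpansion_congr_on h (fun σ₀ hσ₀ u hu => ?_),
    fun ω => B13JointWalkExpansionNeumann.domBy_chain_right (fun ω => domBy_entryDist hLw0 ω) (fun ω => domBy_entryDist hLw0 ω) ω⟩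
  -- `G₀·(1 − R)⁻¹ = G·(1 − R)·(1 − R)⁻¹ = G`
  rw [← toMatrix_G_mul_one_sub_R 𝔬 hI, Matrix.mul_assoc, hinv σ₀ hσ₀ u hu, Matrix.mul_one]

/-- **(3.106) FOR N06's LETTERS: `1 − R(U)` IS INVERTIBLE AND `G(U) = G₀(U)(1 − R(U))⁻¹`** (complex matrices) under «M sufficiently
large» — the invertibility comes from the walk data of the remainder alone (`one_sub_mul_inv_of_jointWalkExpansion`), the identity from
`GΔ_a = I` and (3.105). [cite: Balaban1985BackgroundPropagators, (3.105)–(3.106) p.414, p.422] -/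
theorem toMatrix_G_eq_parametrix_mul_inv {θ₀ δ₀ NF : ℝ}
    (hF : Factors389 𝔬 Rr H θ₀ δ₀ U) (hI : Identities310 𝔬 Rr H U)
    (hcntF : ∀ s : UT Nf, (∑ a, if s ∈ 𝔬.SF a then (1 : ℝ) else 0) ≤ NF) (hθ₀ : 0 ≤ θ₀ * M⁻¹) (hNF : 0 ≤ NF) [Nonempty (UT Nf)]
    (c : B13.Consts) {m : ℕ} (hfib : ∀ y : UT Nf, (Finset.univ.filter fun k => 𝔬.blk k = y).card ≤ m)
    {ρ ε κ μ : ℝ} (hμ : 0 < μ) (hε : 0 ≤ ε) (hκ : 0 ≤ κ) (hwin : κ + 2 * μ ≤ ρ - ε) (hρδ : ρ + μ ≤ δ₀)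
    (hq : (m * B6.c0 1 μ ^ ν) * ((NF * (θ₀ * M⁻¹)) * (m * m + 1)) * B6.c0 1 μ ^ ν < 1) :
    (1 - (LinearMap.toMatrix' (∑ a, 𝔬.Rf U a)).map (algebraMap ℝ ℂ)) *
        (1 - (LinearMap.toMatrix' (∑ a, 𝔬.Rf U a)).map (algebraMap ℝ ℂ))⁻¹ = 1 ∧
      (LinearMap.toMatrix' (𝔬.G U)).map (algebraMap ℝ ℂ) =
        (LinearMap.toMatrix' (∑ i, mulOp (𝔬.h i) * 𝔬.Gsq U i * mulOp (𝔬.h i))).map (algebraMap ℝ ℂ) *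
          (1 - (LinearMap.toMatrix' (∑ a, 𝔬.Rf U a)).map (algebraMap ℝ ℂ))⁻¹ := by
  classical
  obtain ⟨y₀⟩ := ‹Nonempty (UT Nf)›
  have hc : 0 ≤ B6.c0 1 μ ^ ν := pow_nonneg (B6RandomWalk.c0_nonneg 1 μ) ν
  have hρε : 0 < ρ - ε := by linarith
  have hLR := rawEntryLetters_remainder (E := ℂ) 𝔬 hF hcntF hθ₀ hNF 1
  set Lw : ℝ := (Fintype.card (X × X) : ℝ) / (ρ - ε) with hLw
  have hLw0 : 0 ≤ Lw := div_nonneg (Nat.cast_nonneg _) hρε.le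
  have hLwW' : (Fintype.card (X × X) : ℝ) ≤ (δ₀ - (δ₀ - (ρ - ε))) * Lw := by
    have e : δ₀ - (δ₀ - (ρ - ε)) = ρ - ε := by ring
    rw [e, hLw, mul_div_cancel₀ _ hρε.ne']
  have hK := jointWalkExpansion_rawEntrywise (d := 0) (N' := 1) c (Finset.singleton_nonempty y₀) hLR (ε := δ₀ - (ρ - ε)) (kap := κ + μ) (L := Lw)
    (by linarith) (by linarith) hLw0 hLwW' hfib
  have hinv := one_sub_mul_inv_of_jointWalkExpansion (σ₁ := μ) (σ' := μ) (ρ := ρ) hK (fun ω => domBy_entryDist hLw0 ω)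
    hfib (rowSum_torus Nf hμ) (rowSum_torus Nf hμ) hμ.le hμ.le hc (by linarith) (by linarith) hρδ (by linarith)
    (mul_nonneg hLR.B_nonneg (by positivity)) (by linarith) hq (σ₀ := fun _ => 0) (fun _ => by simpa using (Real.exp_pos _).le)
    (u := (0 : ℂ)) (by simp)
  refine ⟨hinv, ?_⟩
  rw [← toMatrix_G_mul_one_sub_R 𝔬 hI, Matrix.mul_assoc, hinv, Matrix.mul_one]

/-- **(3.108) FOR `G(U)` IN [B13] CURRENCY — THE N10 JUNCTION's ENTRYWISE LETTER FROM N06's LETTERS**: under the data of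
`jointWalkExpansion_G_of_ops310`, `‖G(U)_{xx′}‖ ≤ N·B₀η²·(m²+1)·(1 − q)⁻¹·e^{−κ·d₁(blk x, blk x′)}` and `G(U)` (read as a complex
matrix, configuration-constant) is a `RawEntryLetters` datum on every ball — the shape `hEL` of the entrywise junction edition
`Summit…N10AtRecord11B13WalksBlockEntrywise`, at this background. [cite: Balaban1985BackgroundPropagators, Thm 3.10 (3.108) p.416, (3.106) p.414; Balaban1988RG2Cluster, p.13, p.15] -/
theorem rawEntryLetters_G_of_ops310 {θ₀ δ₀ B₀ N NF : ℝ}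
    (hF : Factors389 𝔬 Rr H θ₀ δ₀ U) (hG0 : Local342G 𝔬 Rr H B₀ δ₀ U) (hI : Identities310 𝔬 Rr H U)
    (hh : ∀ i x, |𝔬.h i x| ≤ 1) (hS : ∀ i x, 𝔬.h i x ≠ 0 → 𝔬.blk x ∈ 𝔬.S i)
    (hcnt : ∀ s : UT Nf, (∑ i, if s ∈ 𝔬.S i then (1 : ℝ) else 0) ≤ N)
    (hcntF : ∀ s : UT Nf, (∑ a, if s ∈ 𝔬.SF a then (1 : ℝ) else 0) ≤ NF)
    (hθ₀ : 0 ≤ θ₀ * M⁻¹) (hB₀ : 0 ≤ B₀) (hN : 0 ≤ N) (hNF : 0 ≤ NF) [Nonempty (UT Nf)] (c : B13.Consts)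
    {m : ℕ} (hfib : ∀ y : UT Nf, (Finset.univ.filter fun k => 𝔬.blk k = y).card ≤ m)
    {ρ ε κ μ : ℝ} (hμ : 0 < μ) (hε : 0 ≤ ε) (hκ : 0 ≤ κ) (hwin : κ + 2 * μ ≤ ρ - ε) (hρδ : ρ + μ ≤ δ₀)
    (hq : (m * B6.c0 1 μ ^ ν) * ((NF * (θ₀ * M⁻¹)) * (m * m + 1)) * B6.c0 1 μ ^ ν < 1) (Rball : ℝ) :
    RawEntryLetters (Nf := Nf) (fun (_ : E) => (LinearMap.toMatrix' (𝔬.G U)).map (algebraMap ℝ ℂ)) 𝔬.blk Rball κ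
      ((N * (B₀ * η ^ 2)) * (m * m + 1) * (1 - (m * B6.c0 1 μ ^ ν) * ((NF * (θ₀ * M⁻¹)) * (m * m + 1)) *
        B6.c0 1 μ ^ ν)⁻¹) := by
  classical
  obtain ⟨y₀⟩ := ‹Nonempty (UT Nf)›
  -- any ball radius: run the expansion on the ball of radius `|Rball| + 1` (so that `0` is inside) with `E := E`, σ-index trivial
  obtain ⟨W, T, SX, Aw, D, hJ, -⟩ := jointWalkExpansion_G_of_ops310 (E := E) 𝔬 hF hG0 hI hh hS hcnt hcntF hθ₀ hB₀ hN hNF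
    c (dσ := 0) (Nσ := 1) {y₀} (Finset.singleton_nonempty y₀) (|Rball| + 1) hfib hμ hε hκ hwin hρδ hq
  have hmaj := hJ.majorants hε (fun _ => 0) (fun _ => by simpa using (Real.exp_pos _).le)
  refine
    { decay := fun u _ x x' => hmaj 0 (by simp [Metric.mem_ball]; positivity) x x'
      holo := fun _ _ => differentiableOn_const _
      B_nonneg := ?_ }
  have hc : 0 ≤ B6.c0 1 μ ^ ν := pow_nonneg (B6RandomWalk.c0_nonneg 1 μ) ν
  exact mul_nonneg (by positivity) (inv_nonneg.2 (by nlinarith [mul_nonneg (mul_nonneg (mul_nonneg (Nat.cast_nonneg m) hc)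
    (mul_nonneg (mul_nonneg hNF hθ₀) (by positivity : (0:ℝ) ≤ (m : ℝ) * m + 1))) hc]))

end Thm310

end Literature.MathematicalPhysics.QuantumFieldTheory.Balaban1983to89.B13WalksOfB9Factors

end
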